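import Summits.BirchSwinnertonDyer.BirchSwinnertonDyer.Theorems.Rank1ResidualJetThm63LocalFactsPrime
import Summits.BirchSwinnertonDyer.BirchSwinnertonDyer.Theorems.Rank1ResidualJetKolyvaginClassStringent
import Literature.NumberTheory.EllipticCurves.HeegnerPointsOfConductorRationalityProofs
import Literature.NumberTheory.EllipticCurves.RingClassGalOverCyclicProofs
import Literature.NumberTheory.NumberFields.PureCubicGenusDivisorLemmas
import HarnessLib

/-!
# T1 JET (cell `bsd-jet`), road K: the H63 line with the completion-layer gap `h49str` (K-GAP-2,
# Jetchev Prop. 4.9 proper at the carrier pair) DISCHARGED — `JET.tamagawaExponent_le_mInfty_of_localFacts''`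

HONEST FRAMING (programme file §HONESTY, verbatim): «no tranche here proves BSD; ARM L moves the
LITERAL column of an r ≤ 1 census into the kernel-proved-modulo-named-print column.» THEOREMS ONLY
(seat `bsd-jet-pv-1`, session g7; `--supports stmt-BirchSwinnertonDyer-14418`, helper); 0 classes
move. WHAT THIS IS. pv-2's `JET.tamagawaExponent_le_mInfty_of_localFacts'` (p515562) carries the binder
`h49str` — «`loc_q c_k(cℓ) ∈ 𝒮_q` at `q ∈ {v₀, τ•v₀}`» (Jetchev 2008 Prop. 4.9 proper = printed Prop. 4.1
at the places over the carrier `q ∣ N`), classified K-GAP-2 (a completion-layer KERNEL gap: a statement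
about OUR `kolyvaginClass`, no print fact can replace it; TARGET row T1-R-K-GAPS). It is PROVED:
* `localization_kolyvaginClass_mem_stringentFamily_carrier` — the binder IN FRAME (from the H63 frame's
  own `hGZ` = [GZ86 III (3.1)] receptacle schema with its `n′`, `ρ̄_{E,p}` onto, `d_K ∉ {−3,−4}`, Heegner
  hypothesis): `JET.localization_kolyvaginClass_mem_stringentFamily_of_GZ31` (…KolyvaginClassStringent,
  every place `v ∤ cℓ`) at the carrier pair, which lies over `N` and hence not over the Kolyvagin
  conductor `cℓ` (prime to `N`);
* `tamagawaExponent_le_mInfty_of_localFacts''` — `…_of_localFacts'` with `h49str` DISCHARGED.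
The argument behind it (files …StringentMechanism / …UnramifiedNodeLiftE0 / …CuspLiftE0 / …CoboundaryE0 /
…UnramifiedReceptacleCoboundary / …ReceptacleRational / …StringentEnd / …KolyvaginClassStringent): Gross's
bad-place mechanism with the Milne I.3.8 coboundary witnessed IN `E⁰(K̄_q)` (Lang), `Q' = n′Q_q − S`,
`nQ' = n′P_q − nS ∈ E⁰ ∩ E(K_q) = E₀(K_q)`, `δ_q(b·t) = loc_q c` — uniform in `q = p` / `q ≠ p`
(no use of Jetchev's Lemma 4.3), i.e. buckets A and B of the census alike. What is LEFT on the line: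
named print {`h44`, `h53`, `hGZ`, `hPT`} + {`hloc`, `h𝒯σ`, `h𝒯sd`} (all three now tree theorems, fed by
name by their owners) + the ONE gap `htr`/`h49tr` (K-GAP-1, Howard 2004 Lemma 2.7.3, pv-2).
References: [cite: Jetchev2008, Thm. 5.2 (p. 821), Prop. 4.1 (pp. 819–821), Def. 4.8, Prop. 4.9, §3.1]
[cite: GrossLMS1991, Prop. 6.2 (1) pp. 244–245] [cite: GrossZagier1986, III (3.1)]
[cite: MilneADT2006, Ch. I Prop. 3.8] [cite: Howard2004HeegnerKolyvagin, Lemma 2.7.3].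
-/

set_option autoImplicit false

noncomputable section

open scoped Classical Pointwise

open WeierstrassCurve IsDedekindDomain NumberField Field Literature.NumberTheory.EllipticCurves
  Literature.NumberTheory.EllipticCurves.ModularForms Literature.NumberTheory.EllipticCurves.Jetchev2008
  Literature.NumberTheory.GaloisRepresentations Literature.NumberTheory.GaloisCohomology
  Literature.NumberTheory.GaloisRepresentations.DiscreteGaloisModule
  Summit.BirchSwinnertonDyer.Rank1Residual.X11b Summit.BirchSwinnertonDyer.Rank1Residual.X11b.Three
  Summit.BirchSwinnertonDyer.Rank1Residual.JET.SelmerVocabulary Literature.NumberTheory.Automorphic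

namespace Summit.BirchSwinnertonDyer.Rank1Residual.JET

/-- **K-GAP-2 `h49str` IN FRAME (the frame of `…_of_localFacts'`): `loc_q c_k(cℓ) ∈ 𝒮_q` at the carrier
pair `q ∈ {v₀, τ•v₀}`**
(Jetchev 2008 Prop. 4.9 proper = printed Prop. 4.1 at the places over the carrier prime). From
`localization_kolyvaginClass_mem_stringentFamily_of_GZ31` (every place not over the conductor `cℓ`):
`v₀` and `τ•v₀` lie over `N`, and a Kolyvagin conductor is prime to `N`. Inputs: the H63 frame's `hGZ`
([GZ86 III (3.1)] receptacle schema, cite-only) with `n′` prime to `p`, `ρ̄_{E,p}` onto, `d_K ∉ {−3,−4}`,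
the Heegner hypothesis; the Gross §3 CM facts are the tree's `_holds` theorems.
[cite: Jetchev2008, Prop. 4.9 (arXiv) = Prop. 4.1 (pp. 819–821)] [cite: GrossZagier1986, III (3.1)] -/
theorem localization_kolyvaginClass_mem_stringentFamily_carrier
    (W : WeierstrassCurve ℚ) [W.IsElliptic] [W.IsGloballyMinimal] [NeZero (W.conductorNorm ℤ)]
    (K : Type) [Field K] [NumberField K] (hK : IsImaginaryQuadratic K)
    (hD3 : NumberField.discr K ≠ -3) (hD4 : NumberField.discr K ≠ -4)
    (hH : SatisfiesHeegnerHypothesis (W.conductorNorm ℤ) K)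
    {p : ℕ} [Fact p.Prime] (hp2 : p ≠ 2) (hρ : W.HasSurjectiveModNGaloisRep p)
    (Dt : ModularParametrizationData W (W.conductorNorm ℤ)) (β : ℤ) (ι : K →+* ℂ)
    [∀ j : ℕ, NumberField (ringClassField K ι j)]
    {n' : ℤ} (hcop' : IsCoprime (p : ℤ) n')
    (hGZ : ∀ (m : ℕ) (dm : KolyvaginHeegnerData Dt β ι m)
      (γ : ringClassField K ι m ≃ₐ[ℚ] ringClassField K ι m), γ ∈ ringClassGal ι m →
      ∀ v : HeightOneSpectrum (𝓞 K), ¬ (W.baseChange K).HasGoodReductionAt v →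
        n' • pointsMap (W.baseChange K) (v.adicCompletion K)
            (dm.toGeomPoints (pointGalHom W (ringClassField K ι m) γ dm.y)) ∈
          E0Receptacle (W.baseChange K) v ∧
        ∀ (ℓ : ℕ), ℓ ∈ m.primeFactors → ∀ (dm' : KolyvaginHeegnerData Dt β ι (m / ℓ))
          (hle : ringClassField K ι (m / ℓ) ≤ ringClassField K ι m),
          n' • pointsMap (W.baseChange K) (v.adicCompletion K)
              (dm.toGeomPoints (pointGalHom W (ringClassField K ι m) γ
                (WeierstrassCurve.Affine.Point.map (W' := W)
                  ((RingClassField.inclusion ι hle).restrictScalars ℚ) dm'.y))) ∈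
            E0Receptacle (W.baseChange K) v)
    (τ : K ≃ₐ[ℚ] K) {k : ℕ} (hn : ((p ^ k : ℕ) : ℤ) ≠ 0) {c : ℕ} (hc : Squarefree c)
    (hcK : ∀ ℓ ∈ c.primeFactors, Zhang2014.IsKolyvaginPrime (W.conductorNorm ℤ) W K p ℓ ∧
      k ≤ Zhang2014.kolyvaginIndex W p ℓ)
    (v₀ : HeightOneSpectrum (𝓞 K)) (hv₀N : ((W.conductorNorm ℤ : ℕ) : 𝓞 K) ∈ v₀.asIdeal) :
    ∀ (ℓ : ℕ), Zhang2014.IsKolyvaginPrime (W.conductorNorm ℤ) W K p ℓ →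
      k ≤ Zhang2014.kolyvaginIndex W p ℓ → ℓ ∉ c.primeFactors →
      ∀ (d' : KolyvaginHeegnerData Dt β ι (c * ℓ)), ∀ q ∈ ({v₀, τ • v₀} : Finset _),
      galoisCohomology.localization ((W.baseChange K).torsionGaloisModule ((p ^ k : ℕ) : ℤ))
          (Sum.inr q) 1 (d'.kolyvaginClass (Fact.out : p.Prime) k) ∈ stringentFamily W K hn (Sum.inr q) := by
  intro ℓ hℓK hkℓ hℓc d' q hq
  have hc0 : c ≠ 0 := hc.ne_zero
  have hℓp : ℓ.Prime := hℓK.1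
  -- `cℓ` is a square-free Kolyvagin conductor of index `≥ k`
  have hℓdvd : ¬ ℓ ∣ c := fun h ↦ hℓc (Nat.mem_primeFactors.mpr ⟨hℓp, h, hc0⟩)
  have hcℓ : Squarefree (c * ℓ) :=
    (Nat.squarefree_mul ((Nat.coprime_comm.mp ((Nat.Prime.coprime_iff_not_dvd hℓp).mpr hℓdvd)))).mpr
      ⟨hc, hℓp.squarefree⟩
  have hcℓK : ∀ ℓ' ∈ (c * ℓ).primeFactors, Zhang2014.IsKolyvaginPrime (W.conductorNorm ℤ) W K p ℓ' ∧
      k ≤ Zhang2014.kolyvaginIndex W p ℓ' := by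
    intro ℓ' hℓ'
    rw [Nat.primeFactors_mul hc0 hℓp.ne_zero, Finset.mem_union, hℓp.primeFactors, Finset.mem_singleton] at hℓ'
    rcases hℓ' with h | rfl
    · exact hcK ℓ' h
    · exact ⟨hℓK, hkℓ⟩
  -- the carrier pair lies over `N`, hence over no prime factor of `cℓ` (all prime to `N`)
  have hqN : ((W.conductorNorm ℤ : ℕ) : 𝓞 K) ∈ q.asIdeal := by
    simp only [Finset.mem_insert, Finset.mem_singleton] at hq
    rcases hq with rfl | rfl
    · exact hv₀N
    · have := (HeightOneSpectrum.smul_mem_smul_asIdeal_iff τ v₀ ((W.conductorNorm ℤ : ℕ) : 𝓞 K)).mpr hv₀N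
      rwa [GlobalDuality.smul_natCast_ringOfIntegers] at this
  have hv : ∀ ℓ' ∈ (c * ℓ).primeFactors, ¬ Jetchev2008.PlaceOver K (Sum.inr q : Place K) ℓ' := by
    rintro ℓ' hℓ' ⟨𝔳, h𝔳, hℓ'𝔳⟩
    have hq𝔳 : q = 𝔳 := Sum.inr_injective h𝔳
    subst hq𝔳
    have hcopN : Nat.Coprime ℓ' (W.conductorNorm ℤ) :=
      (Nat.Prime.coprime_iff_not_dvd (Nat.prime_of_mem_primeFactors hℓ')).mpr (hcℓK ℓ' hℓ').1.2.1
    exact Literature.NumberTheory.NumberFields.Honda1971.natCast_notMem_of_coprime hcopN _ hℓ'𝔳 hqN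
  exact localization_kolyvaginClass_mem_stringentFamily_of_GZ31
    (phi_heegnerPointOfConductor_mem_range_map_ringClassField_holds (W.conductorNorm ℤ) W K)
    exists_generator_ringClassGalOver_holds hK hD3 hD4 hH hp2 hρ Dt β ι hcop' hGZ hcℓ hn hcℓK d'
    (Sum.inr q) hv



/-- **[J] Thm 5.2 at a core vertex — `…_of_localFacts'` with K-GAP-2 `h49str` DISCHARGED.** Everything
as in `tamagawaExponent_le_mInfty_of_localFacts'` (p515562) except that the hypothesis `h49str`
(`loc_q c_k(cℓ) ∈ 𝒮_q` at the carrier pair) is now supplied by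
`localization_kolyvaginClass_mem_stringentFamily_carrier` from the frame's own `hGZ`, `htower 1`, `hK`,
`hD3`, `hD4`, `hH`. What remains: named print {`h44` [McC 4.4], `h53` Gross 5.3, `hGZ` [GZ86 III (3.1)],
`hPT` Poitou–Tate}; local print-to-type {`hloc`, `h𝒯σ`, `h𝒯sd`} (tree theorems, fed by name by their
owners); row data at `v₀`; and the ONE completion-layer gap `htr`/`h49tr` (K-GAP-1). CONCLUSION:
`ord_p c_{v₀}(E/K) ≤ m_∞`. [cite: Jetchev2008, Thm. 5.2 (p. 821) and proof (pp. 821–823), Prop. 4.1,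
Prop. 4.9] [cite: Howard2004HeegnerKolyvagin, Prop. 2.1.9, Lemma 2.7.3] [cite: McCallumLMS1991, §4 Prop. 4.4]
[cite: GrossLMS1991, Prop. 5.3, Prop. 6.2 (1)] [cite: GrossZagier1986, III (3.1)] [cite: MilneADT2006, Ch. I,
Thm. 4.10(b), Prop. 3.8] -/
theorem tamagawaExponent_le_mInfty_of_localFacts''
    (h44 : McCallum1991.prop44_localOrder_kolyvaginClass_mul_eq)
    (W : WeierstrassCurve ℚ) [W.IsElliptic] [W.IsGloballyMinimal] [NeZero (W.conductorNorm ℤ)]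
    (hcm : ¬ W.HasCM) (K : Type) [Field K] [NumberField K] (hK : IsImaginaryQuadratic K)
    (hD3 : NumberField.discr K ≠ -3) (hD4 : NumberField.discr K ≠ -4)
    (hH : SatisfiesHeegnerHypothesis (W.conductorNorm ℤ) K)
    (hPT : poitouTate_selmerStructure_duality_conj K)
    (p : ℕ) [Fact p.Prime] (hp2 : p ≠ 2) (htower : ∀ n : ℕ, W.HasSurjectiveModNGaloisRep (p ^ n : ℕ))
    (Dt : ModularParametrizationData W (W.conductorNorm ℤ)) (β : ℤ) (ι : K →+* ℂ)
    [∀ j : ℕ, NumberField (ringClassField K ι j)]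
    (τ : K ≃ₐ[ℚ] K) (hτ : τ ≠ 1) (hτ2 : τ * τ = 1)
    (ε : ℤ) (hε : ε = 1 ∨ ε = -1)
    (h53 : ∀ (m : ℕ) (dm : KolyvaginHeegnerData Dt β ι m)
      (τm : ringClassField K ι m ≃ₐ[ℚ] ringClassField K ι m),
      (∀ x : ringClassField K ι m, ((τm x : ringClassField K ι m) : ℂ) = starRingEnd ℂ x) →
      ∃ σ' ∈ ringClassGal ι m, IsOfFinAddOrder
        (pointGalHom W (ringClassField K ι m) τm dm.y -
          ε • pointGalHom W (ringClassField K ι m) σ' dm.y))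
    {n' : ℤ} (hcop' : IsCoprime (p : ℤ) n')
    (hGZ : ∀ (m : ℕ) (dm : KolyvaginHeegnerData Dt β ι m)
      (γ : ringClassField K ι m ≃ₐ[ℚ] ringClassField K ι m), γ ∈ ringClassGal ι m →
      ∀ v : HeightOneSpectrum (𝓞 K), ¬ (W.baseChange K).HasGoodReductionAt v →
        n' • pointsMap (W.baseChange K) (v.adicCompletion K)
            (dm.toGeomPoints (pointGalHom W (ringClassField K ι m) γ dm.y)) ∈
          E0Receptacle (W.baseChange K) v ∧
        ∀ (ℓ : ℕ), ℓ ∈ m.primeFactors → ∀ (dm' : KolyvaginHeegnerData Dt β ι (m / ℓ))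
          (hle : ringClassField K ι (m / ℓ) ≤ ringClassField K ι m),
          n' • pointsMap (W.baseChange K) (v.adicCompletion K)
              (dm.toGeomPoints (pointGalHom W (ringClassField K ι m) γ
                (WeierstrassCurve.Affine.Point.map (W' := W)
                  ((RingClassField.inclusion ι hle).restrictScalars ℚ) dm'.y))) ∈
            E0Receptacle (W.baseChange K) v)
    (mdiv m : {c : ℕ // Squarefree c ∧ ∀ ℓ ∈ c.primeFactors,
        Zhang2014.IsKolyvaginPrime (W.conductorNorm ℤ) W K p ℓ} → ℕ∞)
    (hmdiv : ∀ c (u : ℕ), (u : ℕ∞) ≤ mdiv c ↔ ∀ d : KolyvaginHeegnerData Dt β ι c.1,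
      ∃ Q : (W.baseChange (ringClassField K ι c.1)).toAffine.Point,
        ((p ^ u : ℕ) : ℤ) • Q = d.derivedPoint)
    (hm : ∀ c, m c = if mdiv c < Zhang2014.levelIndex W p c.1 then mdiv c else ⊤)
    (k : ℕ) [NeZero (p ^ k)] [Finite (geomTorsion (W.baseChange K) ((p ^ k : ℕ) : ℤ))]
    (hn : ((p ^ k : ℕ) : ℤ) ≠ 0)
    (c : {c : ℕ // Squarefree c ∧ ∀ ℓ ∈ c.primeFactors,
        Zhang2014.IsKolyvaginPrime (W.conductorNorm ℤ) W K p ℓ}) (hk : 1 ≤ k)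
    (hcore : IsGlobalCoreVertex W K ι τ p k c.1) (mInf : ℕ) (hmc : m c = mInf)
    (hkM : (k : ℕ∞) + mInf ≤ Zhang2014.levelIndex W p c.1) (hik : mInf < k)
    -- ROW DATA at the carrier place `v₀`
    (v₀ : HeightOneSpectrum (𝓞 K)) (hv₀ : τ • v₀ ≠ v₀)
    (hv₀N : ((W.conductorNorm ℤ : ℕ) : 𝓞 K) ∈ v₀.asIdeal)
    [hmin : ((W.baseChange K).baseChange (v₀.adicCompletion K)).IsMinimal (v₀.adicCompletionIntegers K)]
    (hc0 : ((W.baseChange K).baseChange (v₀.adicCompletion K)).localTamagawaNumber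
      (v₀.adicCompletionIntegers K) ≠ 0)
    [hΦ : IsAddCyclic (((W.baseChange K).baseChange (v₀.adicCompletion K)).toAffine.Point ⧸
      ((W.baseChange K).baseChange (v₀.adicCompletion K)).goodReductionSubgroup (v₀.adicCompletionIntegers K))]
    (htk : (((W.baseChange K).baseChange (v₀.adicCompletion K)).localTamagawaNumber
      (v₀.adicCompletionIntegers K)).factorization p < k)
    -- LOCAL PRINT-TO-TYPE: the intrinsic transverse condition is `τ`-stable (Gross §3 dihedral)
    (h𝒯σ : ∀ (𝒯 : SelmerStructure ((W.baseChange K).torsionGaloisModule ((p ^ k : ℕ) : ℤ))),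
      (∀ v : HeightOneSpectrum (𝓞 K), 𝒯 (Sum.inr v) =
        ⨅ ℓ ∈ c.1.primeFactors.filter (fun ℓ : ℕ ↦ ((ℓ : ℕ) : 𝓞 K) ∈ v.asIdeal),
          ⨅ (w' : HeightOneSpectrum (𝓞 (ringClassField K ι ℓ))) (_ : w'.asIdeal.LiesOver v.asIdeal),
            letI := (adicCompletionOfLiesOver K (ringClassField K ι ℓ) v w').toAlgebra
            transverseSubgroup (GaloisRep.toLocal v ((W.baseChange K).torsionGaloisModule ((p ^ k : ℕ) : ℤ)))
              (w'.adicCompletion (ringClassField K ι ℓ))) →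
      ∀ (v w : HeightOneSpectrum (𝓞 K)) (h : τ • v = w), v ∈ placesDividing K c.1 →
      ∀ x : galoisCohomology (((W.baseChange K).torsionGaloisModule ((p ^ k : ℕ) : ℤ)).toLocal
        (Sum.inr v : Place K)) 1,
      x ∈ 𝒯 (Sum.inr v) → conjActPlace W τ ((p ^ k : ℕ) : ℤ) h x ∈ 𝒯 (Sum.inr w))
    -- LOCAL PRINT-TO-TYPE: the intrinsic transverse condition is Lagrangian (Howard 2.1.9 (ii))
    (h𝒯sd : ∀ (𝒯 : SelmerStructure ((W.baseChange K).torsionGaloisModule ((p ^ k : ℕ) : ℤ))),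
      (∀ v : HeightOneSpectrum (𝓞 K), 𝒯 (Sum.inr v) =
        ⨅ ℓ ∈ c.1.primeFactors.filter (fun ℓ : ℕ ↦ ((ℓ : ℕ) : 𝓞 K) ∈ v.asIdeal),
          ⨅ (w' : HeightOneSpectrum (𝓞 (ringClassField K ι ℓ))) (_ : w'.asIdeal.LiesOver v.asIdeal),
            letI := (adicCompletionOfLiesOver K (ringClassField K ι ℓ) v w').toAlgebra
            transverseSubgroup (GaloisRep.toLocal v ((W.baseChange K).torsionGaloisModule ((p ^ k : ℕ) : ℤ)))
              (w'.adicCompletion (ringClassField K ι ℓ))) →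
      ∀ (e : geomTorsion (W.baseChange K) ((p ^ k : ℕ) : ℤ) →
          geomTorsion (W.baseChange K) ((p ^ k : ℕ) : ℤ) → AlgebraicClosure K)
        (hμ : ∀ S T, e S T ^ (p ^ k) = 1)
        (hadd₁ : ∀ S₁ S₂ T, e (S₁ + S₂) T = e S₁ T * e S₂ T)
        (hadd₂ : ∀ S T₁ T₂, e S (T₁ + T₂) = e S T₁ * e S T₂)
        (hgal : ∀ (g : absoluteGaloisGroup K) (S T : geomTorsion (W.baseChange K) ((p ^ k : ℕ) : ℤ)),
          g • e S T = e (g • S) (g • T)),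
      (∀ T, e T T = 1) → (∀ T, (∀ S, e S T = 1) → T = 0) →
      ∀ inv : LocalInvariants K (p ^ k), inv.IsPerfect → ∀ v ∈ placesDividing K c.1,
      inv.dualTransported 𝒯 (weilDualIntertwining (W.baseChange K) (p ^ k) e hμ hadd₁ hadd₂ hgal)
        (Sum.inr v) = 𝒯 (Sum.inr v))
    -- LOCAL PRINT-TO-TYPE (Lemma 5.2 (i)–(ii)) at the Kolyvagin primes `λ ∤ c`
    (hloc : ∀ ℓ : ℕ, Zhang2014.IsKolyvaginPrime (W.conductorNorm ℤ) W K p ℓ →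
      k ≤ Zhang2014.kolyvaginIndex W p ℓ → ℓ ∉ c.1.primeFactors →
      ∀ (v : HeightOneSpectrum (𝓞 K)), (ℓ : 𝓞 K) ∈ v.asIdeal → ∀ (hfix : τ • v = v)
        (s : ℤ), s = 1 ∨ s = -1 →
      ((W.baseChange K).kummerSelmerStructure ((p ^ k : ℕ) : ℤ) (Sum.inr v)).relIndex
        ((conjActPlace W τ ((p ^ k : ℕ) : ℤ) hfix - s • AddMonoidHom.id _).ker) = p ^ k)
    -- KERNEL GAPS (completion layer)
    (htr : ∀ (d : KolyvaginHeegnerData Dt β ι c.1), ∀ ℓ ∈ c.1.primeFactors,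
      (d.kolyvaginClass (Fact.out : p.Prime) k :
        galoisCohomology ((W.baseChange K).torsionGaloisModule ((p ^ k : ℕ) : ℤ)) 1) ∈
        transverseKer W K ι ((p ^ k : ℕ) : ℤ) ℓ)
    (h49tr : ∀ (ℓ : ℕ), Zhang2014.IsKolyvaginPrime (W.conductorNorm ℤ) W K p ℓ →
      k ≤ Zhang2014.kolyvaginIndex W p ℓ → ℓ ∉ c.1.primeFactors →
      ∀ (d' : KolyvaginHeegnerData Dt β ι (c.1 * ℓ)), ∀ w ∈ placesDividing K c.1,
      galoisCohomology.localization ((W.baseChange K).torsionGaloisModule ((p ^ k : ℕ) : ℤ))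
          (Sum.inr w) 1 (d'.kolyvaginClass (Fact.out : p.Prime) k) ∈
        ⨅ ℓ' ∈ c.1.primeFactors.filter (fun ℓ' : ℕ ↦ ((ℓ' : ℕ) : 𝓞 K) ∈ w.asIdeal),
          ⨅ (w' : HeightOneSpectrum (𝓞 (ringClassField K ι ℓ'))) (_ : w'.asIdeal.LiesOver w.asIdeal),
            letI := (adicCompletionOfLiesOver K (ringClassField K ι ℓ') w w').toAlgebra
            transverseSubgroup (GaloisRep.toLocal w ((W.baseChange K).torsionGaloisModule ((p ^ k : ℕ) : ℤ)))
              (w'.adicCompletion (ringClassField K ι ℓ'))) :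
    (((W.baseChange K).baseChange (v₀.adicCompletion K)).localTamagawaNumber
      (v₀.adicCompletionIntegers K)).factorization p ≤ mInf :=
  tamagawaExponent_le_mInfty_of_localFacts' h44 W hcm K hK hD3 hD4 hH hPT p hp2 htower Dt β ι τ hτ
    hτ2 ε hε h53 hcop' hGZ mdiv m hmdiv hm k hn c hk hcore mInf hmc hkM hik v₀ hv₀ hv₀N hc0 htk h𝒯σ h𝒯sd
    hloc htr
    (localization_kolyvaginClass_mem_stringentFamily_carrier W K hK hD3 hD4 hH hp2 (by simpa using htower 1)
      Dt β ι hcop' hGZ τ hn c.2.1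
      (fun ℓ hℓ ↦ ⟨c.2.2 ℓ hℓ, Zhang2014.natCast_le_levelIndex_iff.mp (le_self_add.trans hkM) ℓ hℓ⟩)
      v₀ hv₀N)
    h49tr

end Summit.BirchSwinnertonDyer.Rank1Residual.JET

end
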